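import Literature.NumberTheory.EllipticCurves.MuThreeTorsorImage
import HarnessLib

/-!
# Cocycles with values in a `3`-isogeny kernel: the `ℤ/3`-kernel image theorem and Kummer theory
# for cubic characters (Silverman X.4.2 (a); Cohen–Pazuki 2009 §1, the side `D = 1`)

Topic `NumberTheory/EllipticCurves`. Two cohomological supplements to `MuThreeTorsorImage`, used by
the `3`-isogeny descent of a curve with a RATIONAL point `T` of order `3`
(`y² = x³ + (mx + s)²`, Cohen–Pazuki's `D = 1`; kernel `⟨T⟩ ≅ ℤ/3`, dual kernel `≅ μ₃`):

* **`exists_hom_of_galH1Map_eq_zero`** — the `ℤ/3`-KERNEL IMAGE THEOREM: for a `Γ_K`-FIXED point `T`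
  of order `3` and a `Γ_K`-equivariant surjection `f : W(K̄) → W'(K̄)` with `ker f ⊆ {O, ±T}`, every
  class `c ∈ H¹(K, W)` with `f_* c = 0` is the class of a cocycle `σ ↦ n(σ)·T` with
  `n : Γ_K → ℤ/3ℤ` a (locally constant) HOMOMORPHISM — `H¹(K, ℤ/3) = Hom(Γ_K, ℤ/3) ↠ WC(E/K)[φ]`
  (Silverman X.4.2 (a) with trivial action on the kernel; no Hilbert 90 needed).
* **`exists_kummerExp_eq_add`** — KUMMER THEORY for the mod-`3` cyclotomic twist: every locally constant
  twisted homomorphism `n : Γ_K → ℤ/3ℤ`, `n(στ) = n(σ) + ε(σ)n(τ)`, is `kummerExp a + (ε − 1)·j` for some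
  `a ∈ K*`, `j` (Hilbert 90 for locally constant cocycles, as inside the proof of
  `MuThreeKernel.exists_torsorClass_eq_of_galH1Map_eq_zero`); over a field containing `√−3`
  (`eps_eq_one_of_theta_mem_range`: `ε ≡ 1`) this reads `n = kummerExp a`
  (`exists_kummerExp_eq_of_theta_mem_range`): `Hom_cont(Γ_K, ℤ/3) = K*/K*³`.

## References

* [SilvermanAEC2009] J. H. Silverman, *The Arithmetic of Elliptic Curves*, 2nd ed., Thm. X.4.2 (a),
  VIII.§2 (Kummer theory).
* [CohenPazuki2009] H. Cohen, F. Pazuki, Acta Arith. 140 (2009), §1 (Prop. 1.4).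
* [Serre1979] J.-P. Serre, *Local Fields*, Ch. X §1 (Hilbert 90).
-/

noncomputable section

open scoped Classical

universe u

namespace Literature.NumberTheory.EllipticCurves

namespace CPMuDescent

open WeierstrassCurve GaloisRepresentations MordellDescent

variable {K : Type u} [Field K] [CharZero K]

/-! ## The `ℤ/3`-kernel image theorem -/

section ZThree

variable {W W' : WeierstrassCurve K} (T : geomPoints W) (hT0 : T ≠ 0) (hTT : T + T = -T)
  (hfix : ∀ σ : Field.absoluteGaloisGroup K, σ • T = T)
  (f : geomPoints W →+ geomPoints W')
  (hf : ∀ (σ : Field.absoluteGaloisGroup K) (P : geomPoints W), f (σ • P) = σ • f P)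

include hTT in
omit [CharZero K] in
/-- The exponent of a point of `{O, T, −T}`: `O ↦ 0`, `T ↦ 1`, `−T ↦ 2`, read as `n.val • T`.
[cite: SilvermanAEC2009, Thm. X.4.2 (a)] -/
theorem exists_val_nsmul_eq {P : geomPoints W} (hP : P = 0 ∨ P = T ∨ P = -T) :
    ∃ n : ZMod 3, (n.val • T : geomPoints W) = P := by
  rcases hP with h | h | h
  · exact ⟨0, by rw [ZMod.val_zero, zero_nsmul, h]⟩
  · exact ⟨1, by rw [ZMod.val_one, one_nsmul, h]⟩
  · exact ⟨2, by rw [show (2 : ZMod 3).val = 2 from rfl, two_nsmul, hTT, h]⟩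

include hTT in
omit [CharZero K] in
/-- `(3q) • T = O`. [cite: SilvermanAEC2009, Thm. X.4.2 (a)] -/
theorem three_mul_nsmul (q : ℕ) : ((3 * q) • T : geomPoints W) = 0 := by
  have h3 : (3 : ℕ) • T = 0 := by rw [succ_nsmul, two_nsmul, hTT, neg_add_cancel]
  induction q with
  | zero => rw [mul_zero, zero_nsmul]
  | succ q ih => rw [Nat.mul_succ, add_nsmul, ih, h3, add_zero]

include hTT in
omit [CharZero K] in
/-- `(a + b).val • T = a.val • T + b.val • T` (as `3T = O`). [cite: SilvermanAEC2009, Thm. X.4.2 (a)] -/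
theorem val_add_nsmul (a b : ZMod 3) :
    ((a + b).val • T : geomPoints W) = a.val • T + b.val • T := by
  rw [ZMod.val_add, ← add_nsmul]
  conv_rhs => rw [← Nat.mod_add_div (a.val + b.val) 3, add_nsmul, three_mul_nsmul T hTT, add_zero]

include hT0 hTT in
omit [CharZero K] in
/-- `n ↦ n.val • T` is injective on `ℤ/3ℤ`. [cite: SilvermanAEC2009, Thm. X.4.2 (a)] -/
theorem val_nsmul_injective : Function.Injective fun n : ZMod 3 => (n.val • T : geomPoints W) := by
  intro n₁ n₂ h
  simp only at h
  set d := n₁ - n₂ with hd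
  have hn₁ : n₁ = n₂ + d := by rw [hd]; ring
  rw [hn₁, val_add_nsmul T hTT] at h
  have hd0 : (d.val • T : geomPoints W) = 0 := add_eq_left.mp h
  have hlt := d.val_lt
  rcases (by omega : d.val = 0 ∨ d.val = 1 ∨ d.val = 2) with h0 | h1 | h2
  · have : d = 0 := (ZMod.val_eq_zero d).mp h0
    rw [hn₁, this, add_zero]
  · rw [h1, one_nsmul] at hd0; exact absurd hd0 hT0
  · rw [h2, two_nsmul, hTT, neg_eq_zero] at hd0; exact absurd hd0 hT0

include hT0 hTT hfix in
omit [CharZero K] in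
/-- **The `ℤ/3`-kernel image theorem.** For a `Γ_K`-fixed point `T` of order `3` and a
`Γ_K`-equivariant surjection `f : W(K̄) → W'(K̄)` with `ker f ⊆ {O, ±T}`, a class `c ∈ H¹(K, W)` killed
by `f_*` is the class of a cocycle `σ ↦ n(σ) T` with `n : Γ_K → ℤ/3ℤ` a locally constant homomorphism:
`f ∘ g = ∂(fP)` makes `g − ∂P` take values in `{O, ±T}`, and the cocycle identity with `σT = T` is
additivity of `n`. [cite: SilvermanAEC2009, Thm. X.4.2 (a)] -/
theorem exists_hom_of_galH1Map_eq_zero (hsurj : Function.Surjective f)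
    (hker : ∀ P : geomPoints W, f P = 0 → P = 0 ∨ P = T ∨ P = -T)
    (c : W.galH1) (hc : galH1Map f hf c = 0) :
    ∃ (g : contOneCocycles (discreteTopRep (Field.absoluteGaloisGroup K) (geomPoints W)))
      (n : Field.absoluteGaloisGroup K → ZMod 3),
      (∀ σ, g.1 σ = (n σ).val • T) ∧ (∀ σ τ, n (σ * τ) = n σ + n τ) ∧
        IsLocallyConstant n ∧ oneCocycleClass _ g = c := by
  obtain ⟨g, rfl⟩ := oneCocycleClass_surjective _ c
  rw [galH1Map_oneCocycleClass, oneCocycleClass_eq_zero_iff] at hc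
  obtain ⟨Q, hQ⟩ := hc
  obtain ⟨P, rfl⟩ := hsurj Q
  have hQ' : ∀ σ : Field.absoluteGaloisGroup K, f (g.1 σ) = σ • f P - f P := fun σ => hQ σ
  set g' := g - cobCocycle P (continuous_smul_geomPoints _ P) with hg'
  have hg'val : ∀ σ : Field.absoluteGaloisGroup K, g'.1 σ = g.1 σ - (σ • P - P) := fun σ => rfl
  have hg'ker : ∀ σ : Field.absoluteGaloisGroup K, g'.1 σ = 0 ∨ g'.1 σ = T ∨ g'.1 σ = -T := by
    intro σ
    apply hker
    rw [hg'val, map_sub, map_sub, hf, hQ', sub_self]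
  have hclass : oneCocycleClass _ g' = oneCocycleClass _ g := by
    rw [hg', oneCocycleClass_sub, oneCocycleClass_cobCocycle, sub_zero]
  choose n hn using fun σ => exists_val_nsmul_eq T hTT (hg'ker σ)
  have hinj := val_nsmul_injective T hT0 hTT
  have hnmul : ∀ σ τ : Field.absoluteGaloisGroup K, n (σ * τ) = n σ + n τ := by
    intro σ τ
    apply hinj
    simp only
    rw [hn, val_add_nsmul T hTT, hn, hn]
    have e := g'.2 σ τ
    rw [discreteTopRep_ρ_apply] at e
    -- `g'(στ) = g'(σ) + σ g'(τ)` and `σ` fixes `g'(τ) ∈ {O, ±T}`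
    have hσfix : σ • g'.1 τ = g'.1 τ := by
      rw [← hn τ]
      rw [show σ • ((n τ).val • T) = (n τ).val • (σ • T) from
        map_nsmul (DistribSMul.toAddMonoidHom (geomPoints W) σ) _ T, hfix]
    rw [hσfix] at e
    exact e
  have hlc : IsLocallyConstant n := by
    have hglc : IsLocallyConstant g'.1 := (IsLocallyConstant.iff_continuous g'.1).mpr g'.1.continuous
    have hns : n = (fun x : geomPoints W =>
        if h : ∃ m : ZMod 3, (m.val • T : geomPoints W) = x then Classical.choose h else 0) ∘ g'.1 := by
      funext σ
      simp only [Function.comp_apply]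
      have hex : ∃ m : ZMod 3, (m.val • T : geomPoints W) = g'.1 σ := ⟨n σ, hn σ⟩
      rw [dif_pos hex]
      exact hinj ((hn σ).trans (Classical.choose_spec hex).symm)
    rw [hns]
    exact hglc.comp _
  exact ⟨g', n, fun σ => (hn σ).symm, hnmul, hlc, hclass⟩

end ZThree

/-! ## Kummer theory for (twisted) cubic characters -/

section Kummer

/-- **Kummer theory for the mod-`3` cyclotomic twist.** Every locally constant twisted homomorphism
`n : Γ_K → ℤ/3ℤ` (`n(στ) = n(σ) + ε(σ) n(τ)`) is, up to a coboundary `(ε − 1) j`, the Kummer cocycle of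
some `a ∈ K*`: `kummerExp a σ = n σ + (ε σ − 1) j`. Hilbert 90 for the locally constant `K̄*`-valued
cocycle `ω^{n(σ)}` gives `β` with `σβ = ω^{n(σ)}β`, `β³ = a ∈ K*`, `∛a = ω^j β`.
[cite: SilvermanAEC2009, VIII.§2 (Kummer pairing) and Thm. X.4.2 (a)] -/
theorem exists_kummerExp_eq_add (n : Field.absoluteGaloisGroup K → ZMod 3)
    (hn : ∀ σ τ, n (σ * τ) = n σ + eps σ * n τ) (hlc : IsLocallyConstant n) :
    ∃ (a : K) (_ : a ≠ 0) (j : ℕ), ∀ σ, kummerExp a σ = n σ + (eps σ - 1) * j := by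
  set s : Field.absoluteGaloisGroup K → AlgebraicClosure K := fun σ => omega K ^ (n σ).val with hs
  have hs0 : ∀ σ, s σ ≠ 0 := fun σ => pow_ne_zero _ (omega_ne_zero K)
  have hslc : IsLocallyConstant s := by
    have : s = (fun m : ZMod 3 => omega K ^ m.val) ∘ n := rfl
    rw [this]; exact hlc.comp _
  have hscoc : ∀ σ τ : Field.absoluteGaloisGroup K, s (σ * τ) = s σ * σ • s τ := by
    intro σ τ
    change omega K ^ (n (σ * τ)).val = omega K ^ (n σ).val * galAut σ (omega K ^ (n τ).val)
    rw [galAut_omega_pow, ← pow_add, omega_pow_eq_pow_iff, hn]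
    push_cast
    rw [ZMod.natCast_zmod_val, ZMod.natCast_zmod_val, ZMod.natCast_zmod_val, epsNat_cast]
  obtain ⟨β, hβ0, hβ⟩ :=
    absoluteGaloisGroup.exists_eq_smul_div_of_isLocallyConstant_cocycle K hslc hs0 hscoc
  have hσβ : ∀ σ : Field.absoluteGaloisGroup K, galAut σ β = s σ * β := by
    intro σ
    change σ • β = s σ * β
    rw [hβ σ, div_mul_cancel₀ _ hβ0]
  have hs3 : ∀ σ, s σ ^ 3 = 1 := by
    intro σ
    change (omega K ^ (n σ).val) ^ 3 = 1
    rw [← pow_mul, mul_comm, pow_mul, omega_pow_three, one_pow]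
  have hβ3 : ∀ σ : Field.absoluteGaloisGroup K, galAut σ (β ^ 3) = β ^ 3 := by
    intro σ
    rw [map_pow, hσβ, mul_pow, hs3, one_mul]
  obtain ⟨a, hda⟩ := exists_algebraMap_eq_of_forall_galAut hβ3
  have ha0 : a ≠ 0 := by
    rintro rfl
    rw [map_zero, eq_comm] at hda
    exact pow_ne_zero 3 hβ0 hda
  obtain ⟨j, -, hj⟩ : ∃ j < 3, omega K ^ j = cubeRoot a / β := by
    apply exists_pow_eq_of_pow_three_eq_one K
    rw [div_pow, cubeRoot_pow_three, hda, div_self (pow_ne_zero 3 hβ0)]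
  have hroot : cubeRoot a = omega K ^ j * β := by
    rw [hj, div_mul_cancel₀ _ hβ0]
  refine ⟨a, ha0, j, fun σ => ?_⟩
  have h : galAut σ (cubeRoot a) = omega K ^ (epsNat σ * j + (n σ).val + 2 * j) * cubeRoot a := by
    have hω3 := omega_pow_three K
    conv_lhs => rw [hroot, map_mul, galAut_omega_pow, hσβ]
    rw [hroot]
    change omega K ^ (epsNat σ * j) * (omega K ^ (n σ).val * β) =
      omega K ^ (epsNat σ * j + (n σ).val + 2 * j) * (omega K ^ j * β)
    have : omega K ^ (epsNat σ * j + (n σ).val + 2 * j) * (omega K ^ j * β) =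
        omega K ^ (epsNat σ * j) * omega K ^ (n σ).val * (omega K ^ 3) ^ j * β := by ring
    rw [this, hω3, one_pow, mul_one, mul_assoc]
  rw [kummerExp_eq_of_galAut_eq ha0 h]
  push_cast
  rw [epsNat_cast, ZMod.natCast_zmod_val]
  have h3 : (2 : ZMod 3) = -1 := by decide
  rw [h3]
  ring

omit [CharZero K] in
/-- If `√−3 ∈ K` then `Γ_K` fixes `√−3 ∈ K̄`. [cite: CohenPazuki2009, §1.2] -/
theorem galAut_theta_of_mem_range (hθ : theta K ∈ Set.range (algebraMap K (AlgebraicClosure K)))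
    (σ : Field.absoluteGaloisGroup K) : galAut σ (theta K) = theta K := by
  obtain ⟨t, ht⟩ := hθ
  rw [← ht]; exact (galAut σ).commutes t

omit [CharZero K] in
/-- If `√−3 ∈ K` then the mod-`3` cyclotomic sign is trivial: `ε ≡ 1`. [cite: CohenPazuki2009, §1.2] -/
theorem eps_eq_one_of_theta_mem_range (hθ : theta K ∈ Set.range (algebraMap K (AlgebraicClosure K)))
    (σ : Field.absoluteGaloisGroup K) : eps σ = 1 := by
  rw [eps, if_pos (galAut_theta_of_mem_range hθ σ)]

/-- If `K` contains a square root of `−3` then `√−3 ∈ K` (`theta K` is `±` its image).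
[cite: CohenPazuki2009, §1.2] -/
theorem theta_mem_range_of_sq {t : K} (ht : t ^ 2 = -3) :
    theta K ∈ Set.range (algebraMap K (AlgebraicClosure K)) := by
  have h : (algebraMap K (AlgebraicClosure K) t) ^ 2 = theta K ^ 2 := by
    rw [← map_pow, ht, theta_sq, map_neg, map_ofNat]
  rcases sq_eq_sq_iff_eq_or_eq_neg.mp h with h1 | h1
  · exact ⟨t, h1⟩
  · exact ⟨-t, by rw [map_neg, h1, neg_neg]⟩

/-- **Kummer theory over a field containing `√−3`: `Hom_cont(Γ_K, ℤ/3) = K*/K*³`.** Every locally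
constant homomorphism `n : Γ_K → ℤ/3ℤ` is the Kummer character `kummerExp a` of some `a ∈ K*`.
[cite: SilvermanAEC2009, VIII.§2 (Kummer pairing, Prop. VIII.1.6/2.x)] -/
theorem exists_kummerExp_eq_of_theta_mem_range
    (hθ : theta K ∈ Set.range (algebraMap K (AlgebraicClosure K)))
    (n : Field.absoluteGaloisGroup K → ZMod 3) (hn : ∀ σ τ, n (σ * τ) = n σ + n τ)
    (hlc : IsLocallyConstant n) : ∃ (a : K) (_ : a ≠ 0), ∀ σ, kummerExp a σ = n σ := by
  have hn' : ∀ σ τ, n (σ * τ) = n σ + eps σ * n τ := fun σ τ => by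
    rw [eps_eq_one_of_theta_mem_range hθ, one_mul]; exact hn σ τ
  obtain ⟨a, ha, j, h⟩ := exists_kummerExp_eq_add n hn' hlc
  exact ⟨a, ha, fun σ => by rw [h σ, eps_eq_one_of_theta_mem_range hθ, sub_self, zero_mul, add_zero]⟩

/-- Over a field containing `√−3`, `kummerExp (ab) = kummerExp a + kummerExp b`.
[cite: SilvermanAEC2009, VIII.§2] -/
theorem kummerExp_mul_of_theta_mem_range
    (hθ : theta K ∈ Set.range (algebraMap K (AlgebraicClosure K))) {a b : K} (ha : a ≠ 0) (hb : b ≠ 0)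
    (σ : Field.absoluteGaloisGroup K) : kummerExp (a * b) σ = kummerExp a σ + kummerExp b σ := by
  obtain ⟨j, -, hj⟩ := exists_cubeRoot_mul ha hb
  rw [kummerExp_mul_left ha hb hj, eps_eq_one_of_theta_mem_range hθ, sub_self, zero_mul, add_zero]

/-- `kummerExp a ≡ 0` only if `a` is a cube. [cite: SilvermanAEC2009, VIII.§2] -/
theorem exists_eq_cube_of_kummerExp_eq_zero {a : K} (ha : a ≠ 0)
    (h : ∀ σ, kummerExp a σ = 0) : ∃ b : K, b ≠ 0 ∧ a = b ^ 3 :=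
  exists_eq_cube_of_kummerExp_eq ha (j := 0) fun σ => by rw [h σ, mul_zero]

end Kummer

end CPMuDescent

end Literature.NumberTheory.EllipticCurves

end
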